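import Literature.AlgebraicGeometry.Frobenioids.ModelFrobenioidComparisonFull1
import Literature.AlgebraicGeometry.Frobenioids.ModelFrobenioidComparisonFaithful
import Literature.AlgebraicGeometry.Frobenioids.ModelFrobenioidComparisonEssSurj
import Literature.AlgebraicGeometry.Frobenioids.BiratLocalization
import HarnessLib

/-!
# Frobenioids I, Theorem 5.2 (iv), proof step: fullness, second half (the unit twist), and the
equivalence

Mochizuki, *The geometry of Frobenioids I: the general theory*, Kyushu J. Math. **62** (2008)
293–400, §5, proof of Theorem 5.2 (iv), kurims text pp. 102–103 [cite: MochizukiFrdI2008, Thm.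
5.2(iv) p.103]:
"… this functor `C′ → [model]` is manifestly essentially surjective [cf. Theorem 5.1, (i)] and full
[cf. Theorem 5.1, (ii)], hence an equivalence of categories, as desired."

Second half of fullness: a morphism `φ₀ : X → X'` with the right degree, base and divisor
(`exists_hom_of_rel`) has unit part `u₀` with the same divisor as the required `u`, so `u = u₀ ·
ι(ε)`
for a unit `ε ∈ O^×(A)` of `C` (Prop. 4.4 (iii), kernel).  Factor `φ₀ = γ' ≫ λ` with `γ'` of
Frobenius
type; along the isomorphism `j : A^birat ≅ Y^birat` with `π_p ≫ γ'^birat = F(d)^birat ≫ j`, the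
unit `ε`
conjugates to a unit `ε_Y ∈ O^×(Y)`, and the twisted morphism `φ := γ' ≫ ε_Y ≫ λ` has the same
degree,
base and divisor and unit part `u₀ · ι(ε) = u`.  Hence the comparison functor is full; with
faithfulness and essential surjectivity it is an equivalence, which proves `Thm52iv`.
-/

namespace Literature.AlgebraicGeometry.Frobenioids

open CategoryTheory Opposite

universe w v v' u u'

namespace PreFrobenioid

variable {D : Type u} [Category.{v} D] {Φ : Dᵒᵖ ⥤ CommMonCat.{w}}
  {C : Type u'} [Category.{v'} C] {F : C ⥤ ElemFrobenioid Φ} {hF : IsFrobenioid F}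
  {hsq : HasBiratSquares F}

namespace BiratUnits

/-- The `Φ^gp`-divisor of `toHom κ` is `divHom κ`. [cite: MochizukiFrdI2008, Prop. 4.4(iii) p.83] -/
theorem gpDiv_toHom {A : C} (κ : BiratUnits F hF A) :
    Birat.gpDiv (toHom hsq κ) = divHom hF A κ := by
  obtain ⟨q, rfl⟩ := mk_surjective κ
  exact BiratFrac.divGp_toBiratFrac q

/-- `toHom κ` is base-identity. [cite: MochizukiFrdI2008, Prop. 4.4(iv) p.83] -/
theorem gpBase_toHom {A : C} (κ : BiratUnits F hF A) : Birat.gpBase (toHom hsq κ) = 𝟙 _ := by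
  obtain ⟨q, rfl⟩ := mk_surjective κ
  haveI : IsIso (Base F q.den) := q.den_mem.2.2
  rw [toHom_mk]
  change inv (Base F q.den) ≫ Base F q.num = 𝟙 _
  rw [← q.baseEq, IsIso.inv_hom_id]

/-- `toHom κ` is linear. [cite: MochizukiFrdI2008, Prop. 4.4(iv) p.83] -/
theorem gpDeg_toHom {A : C} (κ : BiratUnits F hF A) : Birat.gpDeg (toHom hsq κ) = 1 := by
  obtain ⟨q, rfl⟩ := mk_surjective κ
  exact q.num_mem.2.1

/-- Base-identity linear endomorphisms of `A^birat` are rational functions (isotropic type; Prop.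
4.4
(iv), last clause). [cite: MochizukiFrdI2008, Prop. 4.4(iv) p.83] -/
theorem exists_toHom_eq (hiso : IsOfIsotropicType F) {A : C}
    (g : (toBirat F hF hsq).obj A ⟶ (toBirat F hF hsq).obj A) (hb : Birat.gpBase g = 𝟙 _)
    (hd : Birat.gpDeg g = 1) : ∃ κ : BiratUnits F hF A, toHom hsq κ = g := by
  obtain ⟨f, rfl⟩ := Birat.homMk_surjective g
  haveI : IsIso (Base F f.den) := f.den_mem.2.2
  have hbase : Base F f.num = Base F f.den := by
    have h : inv (Base F f.den) ≫ Base F f.num = 𝟙 (baseObj F A) := hb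
    exact ((IsIso.inv_comp_eq _).mp h).trans (Category.comp_id _)
  have hnum : IsCoAngularPreStep F f.num := by
    refine isCoAngularPreStep_of_isotropic hiso ⟨hd, ?_⟩
    change IsIso (Base F f.num)
    rw [hbase]
    infer_instance
  exact ⟨mk hF ⟨f.src, f.den, f.num, f.den_mem, hnum, hbase.symm⟩, rfl⟩

/-- An isomorphism of `C^birat` (between images of objects) and its inverse have degree `1`.
[cite: MochizukiFrdI2008, Def. 1.1(iii)] -/
theorem gpDeg_eq_one_of_isIso {A Y : C} (j : (toBirat F hF hsq).obj A ⟶ (toBirat F hF hsq).obj Y)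
    [IsIso j] : Birat.gpDeg j = 1 ∧ Birat.gpDeg (inv j) = 1 := by
  have h : Birat.gpDeg j * Birat.gpDeg (inv j) = 1 := by
    rw [← Birat.gpDeg_comp, IsIso.hom_inv_id]
    exact degFr_id (Birat.toElemGp hF hsq) _
  have h' := congrArg PNat.val h
  rw [PNat.mul_coe] at h'
  exact ⟨PNat.eq (Nat.eq_one_of_mul_eq_one_right h'), PNat.eq (Nat.eq_one_of_mul_eq_one_left h')⟩

/-- Conjugating a divisor-free rational function of `A` by an isomorphism `A^birat ≅ Y^birat` gives
a
divisor-free rational function of `Y` (isotropic type). [cite: MochizukiFrdI2008, Prop. 4.4(iii)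
p.83] -/
theorem exists_conj (hiso : IsOfIsotropicType F) {A Y : C}
    (j : (toBirat F hF hsq).obj A ⟶ (toBirat F hF hsq).obj Y) [IsIso j] (κ : BiratUnits F hF A)
    (hκ : divHom hF A κ = 1) :
    ∃ κY : BiratUnits F hF Y, toHom hsq κY = inv j ≫ toHom hsq κ ≫ j ∧ divHom hF Y κY = 1 := by
  obtain ⟨h1, h2⟩ := gpDeg_eq_one_of_isIso (hF := hF) (hsq := hsq) j
  have hb : Birat.gpBase (inv j ≫ toHom hsq κ ≫ j) = 𝟙 _ := by
    rw [Birat.gpBase_comp, Birat.gpBase_comp, gpBase_toHom, Category.id_comp, ← Birat.gpBase_comp,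
      IsIso.inv_hom_id]
    exact base_id (Birat.toElemGp hF hsq) _
  have hd : Birat.gpDeg (inv j ≫ toHom hsq κ ≫ j) = 1 := by
    rw [Birat.gpDeg_comp, Birat.gpDeg_comp, gpDeg_toHom, h1, h2, mul_one, mul_one]
  obtain ⟨κY, hκY⟩ := exists_toHom_eq (hF := hF) hiso _ hb hd
  refine ⟨κY, hκY, ?_⟩
  have hc : Birat.gpDiv (toHom hsq κ ≫ j) = Birat.gpDiv j := by
    rw [Birat.gpDiv_comp, gpBase_toHom, pullGp_id, gpDiv_toHom, hκ, one_pow, mul_one]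
  have hdc : Birat.gpDeg (toHom hsq κ ≫ j) = Birat.gpDeg j := by
    rw [Birat.gpDeg_comp, gpDeg_toHom, one_mul]
  have hid : Birat.gpDiv (inv j ≫ j) = 1 := by
    rw [IsIso.inv_hom_id]
    unfold Birat.gpDiv
    rw [CategoryTheory.Functor.map_id]
    rfl
  rw [← gpDiv_toHom (hsq := hsq), hκY, Birat.gpDiv_comp, hc, hdc, ← Birat.gpDiv_comp, hid]

end BiratUnits

namespace FPPath

variable {P : Presection C} {Fr : ℕ+ →* CategoryTheory.End P.ι} {X X' : C}

/-- Along a morphism of Frobenius type `γ' : X → Y` of degree `d`, the path isomorphism `π_p` and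
the
`F`-distinguished `F(d)_A` differ by an ISOMORPHISM of `C^birat`: `π_p ≫ γ'^birat = F(d)_A^birat ≫
j`
(Def. 1.3 (ii) uniqueness, after Def. 1.3 (iv)(a)). [cite: MochizukiFrdI2008, Thm. 5.2(iv) p.102] -/
theorem exists_iso_pathIso_comp (hPF : IsBaseFrobeniusPair F P Fr) (hiso : IsOfIsotropicType F)
    (p : FPPath F {A | P.obj A} X) {Y : C} (γ' : X ⟶ Y) (hγ' : IsFrobeniusType F γ') (d : ℕ+)
    (hd : degFr F γ' = d) :
    ∃ j : (toBirat F hF hsq).obj p.A ⟶ (toBirat F hF hsq).obj Y, IsIso j ∧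
      pathIso hF hsq p ≫ (toBirat F hF hsq).map γ' = (toBirat F hF hsq).map (p.frob Fr d) ≫ j := by
  haveI : IsIso (Base F p.ζX) := p.ζX_mem.2.2
  haveI : IsIso (Base F p.ζA) := p.ζA_mem.2.2
  -- `ζ_X ≫ γ' = γ'' ≫ β''` and `ζ_A ≫ F(d) = γ₃ ≫ β₃`
  have hb1 : IsBaseIso F (p.ζX ≫ γ') := by
    haveI : IsIso (Base F γ') := hγ'.2
    change IsIso (Base F (p.ζX ≫ γ'))
    rw [base_comp]
    infer_instance
  have hb2 : IsBaseIso F (p.ζA ≫ p.frob Fr d) := by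
    change IsIso (Base F (p.ζA ≫ p.frob Fr d))
    rw [base_comp, base_frob hPF, Category.comp_id]
    infer_instance
  obtain ⟨Y'', γ'', β'', hfac₁, hγ'', hβ'', hdeg₁⟩ :=
    exists_frobeniusType_preStep_factorisation hF (p.ζX ≫ γ') hb1
  obtain ⟨Y₃, γ₃, β₃, hfac₂, hγ₃, hβ₃, hdeg₂⟩ :=
    exists_frobeniusType_preStep_factorisation hF (p.ζA ≫ p.frob Fr d) hb2
  have hdd : degFr F γ'' = degFr F γ₃ := by
    rw [hdeg₁, hdeg₂, degFr_comp, degFr_comp, p.ζX_mem.2.1, p.ζA_mem.2.1, one_mul, one_mul, hd,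
      degFr_frob hPF]
  obtain ⟨i, hi⟩ := hF.ii_unique γ'' γ₃ hγ'' hγ₃ hdd
  have hc₁ : IsCoAngularPreStep F (i.hom ≫ β₃) :=
    isCoAngularPreStep_of_isotropic hiso (IsPreStep.comp F (isPreStep_of_isIso F i.hom) hβ₃)
  have hc₂ : IsCoAngularPreStep F β'' := isCoAngularPreStep_of_isotropic hiso hβ''
  haveI := Birat.isIso_toBirat_map (hF := hF) (hsq := hsq) (i.hom ≫ β₃) hc₁
  haveI := Birat.isIso_toBirat_map (hF := hF) (hsq := hsq) β'' hc₂
  haveI := Birat.isIso_toBirat_map (hF := hF) (hsq := hsq) p.ζA p.ζA_mem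
  refine ⟨inv ((toBirat F hF hsq).map (i.hom ≫ β₃)) ≫ (toBirat F hF hsq).map β'', inferInstance, ?_⟩
  -- `ζ_A^birat ≫ F(d)^birat = γ''^birat ≫ (i ≫ β₃)^birat`
  have key : (toBirat F hF hsq).map p.ζA ≫ (toBirat F hF hsq).map (p.frob Fr d) =
      (toBirat F hF hsq).map γ'' ≫ (toBirat F hF hsq).map (i.hom ≫ β₃) := by
    rw [← Functor.map_comp, ← Functor.map_comp, ← hfac₂, ← hi, Category.assoc]
  have key' : (toBirat F hF hsq).map (p.frob Fr d) ≫ inv ((toBirat F hF hsq).map (i.hom ≫ β₃)) =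
      inv ((toBirat F hF hsq).map p.ζA) ≫ (toBirat F hF hsq).map γ'' := by
    rw [IsIso.eq_inv_comp, ← Category.assoc, key, Category.assoc, IsIso.hom_inv_id,
      Category.comp_id]
  unfold pathIso
  rw [Category.assoc, ← Functor.map_comp, ← hfac₁, Functor.map_comp, ← Category.assoc
    ((toBirat F hF hsq).map (p.frob Fr d)), key', Category.assoc]

/-- **The comparison functor is full** (isotropic + model type, unit datum from `R`).
[cite: MochizukiFrdI2008, Thm. 5.2(iv) p.103] -/
theorem comparison_full (hPF : IsBaseFrobeniusPair F P Fr) (hiso : IsOfIsotropicType F)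
    (hbfn : ∀ A : C, IsBiratFrobeniusNormalized F hF hsq A) {B : Dᵒᵖ ⥤ CommMonCat.{w}}
    {DivB : B ⟶ monoidGp Φ} (R : RationalFunctionMonoidStr F hF B DivB) :
    (UnitData.comparison (unitData hF hsq hPF hiso hbfn R)).Full where
  map_surjective {x y} m := by
    -- Step 1: a morphism with the right degree, base, divisor
    obtain ⟨φ₀, hd, hb, hz⟩ := exists_hom_of_rel hF hiso hPF.isBaseSection x.path y.path R
      m.degFr m.base m.div m.unit m.rel
    -- the required unit `u` and the unit `u₀` of `φ₀` have the same divisor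
    set u₀ := unitOf hF hsq hPF hiso x.path y.path φ₀ with hu₀
    set u := R.iso x.path.A m.unit with hu
    have e2 := gpDiv_pathHom (hF := hF) (hsq := hsq) x.path y.path φ₀
    rw [hd, hb, ← divHom_unit_pathHom hPF x.path y.path φ₀ (unitOf_spec hPF hiso x.path y.path φ₀),
      ← hu₀] at e2
    have e3 : pullGp Φ (X := baseObj F x.path.A) (Y := baseObj F y.path.A) m.base y.path.cls *
        BiratUnits.divHom hF x.path.A u₀ =
        pullGp Φ (X := baseObj F x.path.A) (Y := baseObj F y.path.A) m.base y.path.cls *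
          BiratUnits.divHom hF x.path.A u := by
      rw [← e2, hu, R.div_iso, hz]
      exact m.rel
    have hdiv : BiratUnits.divHom hF x.path.A (u₀⁻¹ * u) = 1 := by
      rw [map_mul, map_inv, inv_mul_eq_one]
      exact mul_left_cancel e3
    obtain ⟨ε, hε⟩ : u₀⁻¹ * u ∈ (BiratUnits.unitsToBirat hF x.path.A).range := by
      rw [← BiratUnits.ker_divHom_eq_range]; exact hdiv
    -- Step 2: factor `φ₀ = γ' ≫ β' ≫ α'` and twist in the middle
    obtain ⟨Xm, Y, γ', β', α', hfac, hγ', hβ', hα'⟩ := hF.iv_a_exists φ₀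
    have hdγ' : degFr F γ' = m.degFr := by
      have h := congrArg (degFr F) hfac
      rw [degFr_comp, degFr_comp, hβ'.1, (hF.iv_b α' hα').2, mul_one, mul_one, hd] at h
      exact h
    obtain ⟨j, hj, hjeq⟩ := exists_iso_pathIso_comp (hsq := hsq) hPF hiso x.path γ' hγ' m.degFr hdγ'
    haveI := hj
    obtain ⟨κY, hκY, hκYdiv⟩ := BiratUnits.exists_conj (hF := hF) hiso j
      (BiratUnits.unitsToBirat hF x.path.A ε) (BiratUnits.divHom_unitsToBirat ε)
    obtain ⟨εY, hεY⟩ : κY ∈ (BiratUnits.unitsToBirat hF Xm).range := by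
      rw [← BiratUnits.ker_divHom_eq_range]; exact hκYdiv
    let φ : x.pt ⟶ y.pt := γ' ≫ εY.1.hom ≫ β' ≫ α'
    -- the twisted morphism has the same degree, base, divisor
    have hεb : Base F εY.1.hom = 𝟙 _ := εY.2.1
    have hεd : degFr F εY.1.hom = 1 := εY.2.2
    have hεz : Div F εY.1.hom = 1 := isIsometry_of_isIso F hF.isPreFrobenioid εY.1.hom
    have hφd : degFr F φ = degFr F φ₀ := by
      change degFr F (γ' ≫ εY.1.hom ≫ β' ≫ α') = _
      rw [← hfac]
      simp only [degFr_comp, hεd, one_mul]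
    have hφb : Base F φ = Base F φ₀ := by
      change Base F (γ' ≫ εY.1.hom ≫ β' ≫ α') = _
      rw [← hfac]
      simp only [base_comp, hεb, Category.id_comp]
    have hφz : Div F φ = Div F φ₀ := by
      change Div F (γ' ≫ εY.1.hom ≫ β' ≫ α') = _
      rw [← hfac]
      simp only [div_comp, degFr_comp, hεb, hεd, hεz, pull_id, one_pow, mul_one, one_mul]
    have hbo : FPPath.baseOf x.path y.path φ = FPPath.baseOf x.path y.path φ₀ := by
      unfold FPPath.baseOf; rw [hφb]
    have hdo : FPPath.divOf x.path φ = FPPath.divOf x.path φ₀ := by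
      unfold FPPath.divOf; rw [hφz]
    -- the unit part of the twisted morphism
    have hεb2 : BiratUnits.toHom hsq (BiratUnits.unitsToBirat hF x.path.A ε) =
        (toBirat F hF hsq).map ε.1.hom := rfl
    have hεYb : (toBirat F hF hsq).map εY.1.hom = inv j ≫ (toBirat F hF hsq).map ε.1.hom ≫ j := by
      rw [← hεb2, ← hκY, ← hεY]
      rfl
    have hrest : j ≫ (toBirat F hF hsq).map (β' ≫ α') ≫ pathIsoRev hF hsq y.path =
        BiratUnits.toHom hsq u₀ ≫
          (toBirat F hF hsq).map (ppart hPF.isBaseSection x.path y.path φ₀) := by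
      haveI := Birat.epi_toBirat_map hF hsq (x.path.frob Fr (degFr F φ₀))
      rw [← cancel_epi ((toBirat F hF hsq).map (x.path.frob Fr (degFr F φ₀))),
        ← unitOf_spec hPF hiso x.path y.path φ₀, pathHom_eq, hd, ← reassoc_of% hjeq,
        ← Functor.map_comp_assoc, hfac]
    have hpath : pathHom hF hsq x.path y.path φ =
        (toBirat F hF hsq).map (x.path.frob Fr m.degFr) ≫
          BiratUnits.toHom hsq (u₀ * BiratUnits.unitsToBirat hF x.path.A ε) ≫
            (toBirat F hF hsq).map (ppart hPF.isBaseSection x.path y.path φ₀) := by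
      rw [BiratUnits.toHom_mul, hεb2, Category.assoc, ← hrest, pathHom_eq]
      change pathIso hF hsq x.path ≫ (toBirat F hF hsq).map (γ' ≫ εY.1.hom ≫ β' ≫ α') ≫
        pathIsoRev hF hsq y.path = _
      rw [Functor.map_comp, Functor.map_comp, Category.assoc, Category.assoc, reassoc_of% hjeq,
        hεYb]
      simp only [Category.assoc, IsIso.hom_inv_id_assoc]
    have hpath' : pathHom hF hsq x.path y.path φ =
        (toBirat F hF hsq).map (x.path.frob Fr (degFr F φ)) ≫
          BiratUnits.toHom hsq (u₀ * BiratUnits.unitsToBirat hF x.path.A ε) ≫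
            (toBirat F hF hsq).map (ppart hPF.isBaseSection x.path y.path φ) := by
      rw [hφd, hd, ppart_congr hPF.isBaseSection x.path y.path hbo]
      exact hpath
    have hunit : unitOf hF hsq hPF hiso x.path y.path φ = u := by
      rw [unit_pathHom_unique hPF x.path y.path φ (unitOf_spec hPF hiso x.path y.path φ) hpath', hε,
        mul_inv_cancel_left]
    -- conclude
    refine ⟨InducedCategory.homMk φ, ?_⟩
    apply ModelFrobenioid.hom_ext
    · exact hφd.trans hd
    · exact hbo.trans hb
    · exact hdo.trans hz
    · change (R.iso x.path.A).symm (unitOf hF hsq hPF hiso x.path y.path φ) = m.unit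
      rw [hunit, hu, MulEquiv.symm_apply_apply]

/-- **The comparison functor is an equivalence of categories.** [cite: MochizukiFrdI2008, Thm.
5.2(iv) p.103] -/
theorem comparison_isEquivalence (hPF : IsBaseFrobeniusPair F P Fr) (hiso : IsOfIsotropicType F)
    (hbfn : ∀ A : C, IsBiratFrobeniusNormalized F hF hsq A) {B : Dᵒᵖ ⥤ CommMonCat.{w}}
    {DivB : B ⟶ monoidGp Φ} (R : RationalFunctionMonoidStr F hF B DivB) :
    (UnitData.comparison (unitData hF hsq hPF hiso hbfn R)).IsEquivalence :=
  haveI := comparison_faithful (hsq := hsq) hPF hiso hbfn R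
  haveI := comparison_full (hsq := hsq) hPF hiso hbfn R
  haveI := UnitData.comparison_essSurj (hF := hF) (hsq := hsq) hiso hPF.isBaseSection
    (unitData hF hsq hPF hiso hbfn R)
  {}

end FPPath

/-- **Theorem 5.2 (iv)** (as typed in `ModelFrobenioidComparison.lean`, 2024 form): a Frobenioid of
isotropic and model type, with rational function monoid `B` and `Div_B`, is equivalent to the model
Frobenioid of `(Φ, B, Div_B)`, 1-compatibly with the functors to `F_Φ` — here under the
square-completion
hypothesis `hsq` (Prop. 1.11 (vii)). [cite: MochizukiFrdI2008, Thm. 5.2(iv) p.101] -/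
theorem thm52iv_holds (hF : IsFrobenioid F) (hsq : HasBiratSquares F) : Thm52iv F hF hsq :=
  FPPath.thm52iv_of_isEquivalence hF hsq fun hmod hiso _ _ hPF _ _ R =>
    FPPath.comparison_isEquivalence (hsq := hsq) hPF hiso hmod.2 R

/-- **Theorem 5.2 (iv), unconditional form**: the square-completion hypothesis is Prop. 1.11 (vii),
discharged by seat L6-t6's `hasBiratSquares_of_isFrobenioid`; so for every Frobenioid `C → F_Φ` the
statement `Thm52iv` holds for its birationalization. [cite: MochizukiFrdI2008, Thm. 5.2(iv) p.101] -/
theorem thm52iv_holds' (hF : IsFrobenioid F) : Thm52iv F hF (hasBiratSquares_of_isFrobenioid hF) :=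
  thm52iv_holds hF _

end PreFrobenioid

end Literature.AlgebraicGeometry.Frobenioids
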